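import Summits.MatrixMultiplication.MatrixMultiplication.Theses.DefinableSTPPDichotomy
import Summits.MatrixMultiplication.MatrixMultiplication.Theorems.PairwiseCurvedTilingsLC.Negative.LonelyTranslates
import Summits.MatrixMultiplication.MatrixMultiplication.Theorems.PairwiseCurvedTilingsLC.Negative.ShadowFormulaRealize
import Summits.MatrixMultiplication.MatrixMultiplication.Theorems.PairwiseCurvedTilingsLC.Negative.ShadowCounting
import Summits.MatrixMultiplication.MatrixMultiplication.Theorems.PairwiseCurvedTilingsLC.Negative.LonelyShadowFormula
import Summits.MatrixMultiplication.MatrixMultiplication.Theorems.PairwiseCurvedTilingsLC.Negative.PairwiseCurvedTilingsLCFalseOfEtaleOpenFacts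
import Summits.MatrixMultiplication.MatrixMultiplication.Theorems.PairwiseCurvedTilingsLC.Negative.CharZeroUniformBound
import Summits.MatrixMultiplication.MatrixMultiplication.Theorems.PairwiseCurvedTilingsLC.Negative.GenericInterior
import Summits.MatrixMultiplication.MatrixMultiplication.Theorems.PairwiseCurvedTilingsLC.Negative.ChartInduction
import Summits.MatrixMultiplication.MatrixMultiplication.Theorems.PairwiseCurvedTilingsLC.Negative.AlgebraicBoundednessCharZero
import Summits.MatrixMultiplication.MatrixMultiplication.Theorems.PairwiseCurvedTilingsLC.Negative.PairwiseCurvedTilingsLCFalseOfProp27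
import Literature.ModelTheory.PseudofiniteFields.AlgebraicBoundedness
import Literature.ModelTheory.PseudofiniteFields.EtaleOpenTopologyProofs
import Literature.ModelTheory.PseudofiniteFields.EtaleOpenTopologyBasis
import Literature.ModelTheory.PseudofiniteFields.GenericEtaleInterior
import Literature.ModelTheory.PseudofiniteFields.DefinableSetsFiniteFieldsDecomposition
import Literature.ModelTheory.PseudofiniteFields.DefinableExponentialSums
import Literature.ModelTheory.PseudofiniteFields.FiniteFieldTheory
import Literature.ModelTheory.PseudofiniteFields.CharZeroTransfer

/-!
# `PairwiseCurvedTilingsLC` (crux stmt-MatrixMultiplication-17883) is FALSE — conditionally on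
# CDM Prop. (2.7) ALONE (line LonelyTranslates, continuation c1, stage D)

NEGATIVE LEMMA MODULO ONE PUBLISHED FACT:
`PairwiseCurvedTilingsLC_false_of_ChatzidakisVanDenDriesMacintyre1992_prop27 :
  ChatzidakisVanDenDriesMacintyre1992_prop27 → ¬ PairwiseCurvedTilingsLC`
(Chatzidakis–van den Dries–Macintyre 1992, Prop. (2.7): every ring formula is equivalent,
uniformly in enriched pseudo-finite fields, to a conjunction of one-variable solvability formulas
`∃T g(c, X, T) = 0` — the Ax–Kiefe theory of pseudo-finite fields in CDM's positive form).

This is `not_PairwiseCurvedTilingsLC_of_prop27_of_prop33` (PairwiseCurvedTilingsLCFalseOfProp27.lean)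
with its only use of Prop. (3.3) (Lang–Weil) — the algebraic boundedness of pseudo-finite fields
through the CDM Main Theorem — replaced by `algebraicBoundedness_charZero_of_prop27`
(AlgebraicBoundednessCharZero.lean): in characteristic `0`, a definable set with `C(φ) + 1` points
is infinite, by compactness from the étale-open certificate of infinitude (`exists_certFormula`,
`stub_openPiece`, Johnson–Tran–Walsberg–Ye 7.1 — all theorems of the tree given Prop. (2.7)).
So the refutation of the crux now rests on Prop. (2.7) and nothing else; the lonely-translate
mechanism, the char-`0` reduction and the transfer along the characteristic are as in the module
docstring of PairwiseCurvedTilingsLCFalseOfProp27.lean (`porosityShadowBound_of_prop27_only` below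
is that proof with the new boundedness constant).
-/

set_option linter.dupNamespace false

namespace Summit.MatrixMultiplication.MatrixMultiplication.Theorems.PairwiseCurvedTilingsLC.Negative

open Finset
open FirstOrder FirstOrder.Language FirstOrder.Ring
open Literature.ModelTheory.PseudofiniteFields
open Summit.MatrixMultiplication.MatrixMultiplication.Theses.DefinableSTPPDichotomy

/-! ## The composition -/

section Assembly

variable {e m k : ℕ}

/-- **`PorosityShadowBound` from CDM Prop. (2.7) alone.** -/
theorem porosityShadowBound_of_prop27_only (h27 : ChatzidakisVanDenDriesMacintyre1992_prop27) :
    PorosityShadowBound := by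
  intro e m k φI φA φB φC
  classical
  -- (1) algebraic boundedness constant for the blocks `B_x` (characteristic zero, from Prop. (2.7))
  obtain ⟨C, hC⟩ := algebraicBoundedness_charZero_of_prop27 h27 m (e + k) (blockFormula φB)
  -- (2) the encoding formulas
  choose θ hθ using fun N => stub_exists_lonelyShadowFormula e m k φI φA φB φC C N
  -- (3) in every CHARACTERISTIC-ZERO pseudo-finite field, every `y` satisfies some `θ_N`
  have hpw : ∀ (K : Type) [Field K] [CompatibleRing K] [CharZero K], K ⊨ finiteFieldTheory →
      ∀ y : Fin k → K, ∃ N, (θ N).Realize y := by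
    intro K _ _ _ hK y
    haveI : Infinite K := Infinite.of_injective (Nat.cast : ℕ → K) Nat.cast_injective
    -- realised family (as sets)
    set I : Set (Fin e → K) := {x | φI.Realize (Sum.elim x y)} with hIdef
    set A : (Fin e → K) → Set (Fin m → K) := fun x => {v | φA.Realize (Sum.elim (Sum.elim x v) y)}
      with hAdef
    set B : (Fin e → K) → Set (Fin m → K) := fun x => {v | φB.Realize (Sum.elim (Sum.elim x v) y)}
      with hBdef
    set C' : (Fin e → K) → Set (Fin m → K) := fun x => {v | φC.Realize (Sum.elim (Sum.elim x v) y)}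
      with hCdef
    by_cases hpat : ∀ i ∈ I, ∀ k' ∈ I, ∀ s ∈ A k', ∀ s' ∈ A i, ∀ t ∈ B i, ∀ t' ∈ B i,
        ∀ u ∈ C' i, ∀ u' ∈ C' k', (s' - s) + (t' - t) + (u' - u) = 0 →
          i = k' ∧ s = s' ∧ t = t' ∧ u = u'
    swap
    · -- pattern fails: `θ_0` holds vacuously
      refine ⟨0, (hθ 0 K y).2 fun hp => absurd ?_ hpat⟩
      intro i hi k' hk' s hs s' hs' t ht t' ht' u hu u' hu' h0
      exact hp i hi k' hk' s hs s' hs' t ht t' ht' u hu u' hu' h0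
    -- (a) the shadow is étale-open off a hypersurface `D = 0`
    obtain ⟨D, hD0, hDint⟩ := stub_genericInterior h27 K hK (shadowFormula φI φA φC) y
    have hU : ∀ w ∈ {w | ∃ x ∈ I, ∃ a ∈ A x, ∃ u ∈ C' x, w = a - u}, MvPolynomial.eval w D ≠ 0 →
        ∃ (r : ℕ) (E : EtaleDatum K m r), w ∈ E.image ∧
          E.image ⊆ {w | ∃ x ∈ I, ∃ a ∈ A x, ∃ u ∈ C' x, w = a - u} := by
      have hset : {x : Fin m → K | (shadowFormula φI φA φC).Realize (Sum.elim x y)} =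
          {w | ∃ x ∈ I, ∃ a ∈ A x, ∃ u ∈ C' x, w = a - u} := by
        ext w
        simp only [Set.mem_setOf_eq, stub_realize_shadowFormula_iff]
        constructor
        · rintro ⟨x, hx, a, ha, u, hu, rfl⟩
          exact ⟨x, hx, a, ha, u, hu, rfl⟩
        · rintro ⟨x, hx, a, ha, u, hu, rfl⟩
          exact ⟨x, hx, a, ha, u, hu, rfl⟩
      intro w hw hwD
      have hw' : (shadowFormula φI φA φC).Realize (Sum.elim w y) := by
        have : w ∈ {x : Fin m → K | (shadowFormula φI φA φC).Realize (Sum.elim x y)} := by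
          rw [hset]; exact hw
        exact this
      obtain ⟨r, E, hwE, hEU⟩ := hDint w hw' hwD
      exact ⟨r, E, hwE, hset ▸ hEU⟩
    -- (b) every infinite block has a non-isolated point
    have hB : ∀ x ∈ I, (B x).Infinite → ∃ t₀ ∈ B x, ∀ (r : ℕ) (E : EtaleDatum K m r),
        t₀ ∈ E.image → ∃ t ∈ B x, t ≠ t₀ ∧ t ∈ E.image := by
      intro x _ hBinf
      have hBx : B x = {v | (blockFormula φB).Realize (Sum.elim v (Fin.append x y))} := by
        ext v
        simp only [Set.mem_setOf_eq, realize_blockFormula_iff, hBdef]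
      have hinf' : {v : Fin m → K | (blockFormula φB).Realize (Sum.elim v (Fin.append x y))}.Infinite :=
        hBx ▸ hBinf
      obtain ⟨c, S, X, hcm, hXB, ⟨t₀, ht₀⟩, hXopen⟩ :=
        stub_openPiece h27 K hK (blockFormula φB) (Fin.append x y) hinf'
      refine ⟨t₀, hBx ▸ hXB ht₀, fun r E ht₀E => ?_⟩
      obtain ⟨t, htX, htne, htE⟩ := exists_ne_mem_of_not_isEtaleIsolatedIn S hXopen ht₀
        (JohnsonTranWalsbergYe2024_thm71_psf_holds K hK m c hcm S t₀) E ht₀E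
      exact ⟨t, hBx ▸ hXB htX, htne, htE⟩
    have hDvan := noLonely_of_interior_of_nonisolated I A B C' hpat hU hB
    obtain ⟨d, hd0, hdev⟩ := exists_box_of_ne_zero D hD0 le_rfl
    refine ⟨D.totalDegree, (hθ _ K y).2 fun _ => ⟨d, hd0, ?_⟩⟩
    intro x hx hw a ha u hu
    obtain ⟨w, hwinj, hw⟩ := hw
    have hinf : (B x).Infinite := by
      have := hC K hK (Fin.append x y) w hwinj
        (fun j => (realize_blockFormula_iff φB x y (w j)).2 (hw j))
      simpa [hBdef, realize_blockFormula_iff] using this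
    rw [hdev]
    exact hDvan x hx hinf a ha u hu
  -- (4) a uniform index over characteristic-zero pseudo-finite fields
  obtain ⟨N, hN⟩ := stub_charZeroUniformBound θ hpw
  -- (5) transfer `⋁_{n ≤ N} θ_n` to all finite fields of large characteristic
  set ψ : Language.ring.Formula (Fin k) := BoundedFormula.iSup (fun n : Fin (N + 1) => θ n) with hψ
  have hψK : ∀ (K : Type) [Field K] [CompatibleRing K] [CharZero K], K ⊨ finiteFieldTheory →
      ∀ y : Fin k → K, ψ.Realize y := by
    intro K _ _ _ hK y
    obtain ⟨n, hn, hreal⟩ := hN K hK y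
    rw [hψ, Formula.Realize, BoundedFormula.realize_iSup]
    exact ⟨⟨n, Nat.lt_succ_of_le hn⟩, hreal⟩
  obtain ⟨q₀, hq₀⟩ := FiniteField.eventually_realize_forall_of_pseudoFinite_charZero ψ hψK
  -- (6) the finite-field statement
  refine ⟨max C (m * N), q₀, ?_⟩
  intro F _ _ instCR hchar y I A B C' hI hA hB hC hpat
  have hψF : ψ.Realize y := by
    rw [realize_iff_of_compatibleRing]
    exact hq₀ F hchar y
  rw [hψ, Formula.Realize, BoundedFormula.realize_iSup] at hψF
  obtain ⟨n, hn⟩ := hψF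
  have hsem : LonelyShadowSem e m k φI φA φB φC C n F y := (hθ n F y).1 hn
  have hpat' : ∀ i, φI.Realize (Sum.elim i y) → ∀ i', φI.Realize (Sum.elim i' y) →
      ∀ s, φA.Realize (Sum.elim (Sum.elim i' s) y) → ∀ s', φA.Realize (Sum.elim (Sum.elim i s') y) →
      ∀ t, φB.Realize (Sum.elim (Sum.elim i t) y) → ∀ t', φB.Realize (Sum.elim (Sum.elim i t') y) →
      ∀ u, φC.Realize (Sum.elim (Sum.elim i u) y) →
      ∀ u', φC.Realize (Sum.elim (Sum.elim i' u') y) →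
        (s' - s) + (t' - t) + (u' - u) = 0 → i = i' ∧ s = s' ∧ t = t' ∧ u = u' := by
    intro i hi i' hi' s hs s' hs' t ht t' ht' u hu u' hu' h0
    exact hpat i ((hI i).2 hi) i' ((hI i').2 hi') s ((hA i' s).2 hs) s' ((hA i s').2 hs')
      t ((hB i t).2 ht) t' ((hB i t').2 ht') u ((hC i u).2 hu) u' ((hC i' u').2 hu') h0
  obtain ⟨d, hd0, hdvan⟩ := hsem hpat'
  set Cb : ℕ := max C (m * N) with hCb
  set I₁ := I.filter (fun x => Cb < (B x).card) with hI₁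
  have hI₁I : I₁ ⊆ I := filter_subset _ _
  have hpat₁ : ∀ i ∈ I₁, ∀ k' ∈ I₁, ∀ s ∈ A k', ∀ s' ∈ A i, ∀ t ∈ B i, ∀ t' ∈ B i, ∀ u ∈ C' i,
      ∀ u' ∈ C' k', (s' - s) + (t' - t) + (u' - u) = 0 → i = k' ∧ s = s' ∧ t = t' ∧ u = u' :=
    fun i hi k' hk' => hpat i (hI₁I hi) k' (hI₁I hk')
  have hB₁ : ∀ x ∈ I₁, (B x).Nonempty := fun x hx =>
    card_pos.1 (lt_of_le_of_lt (Nat.zero_le _) (mem_filter.1 hx).2)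
  have hvan : ∀ x ∈ I₁, ∀ a ∈ A x, ∀ u ∈ C' x,
      ∑ β : Fin m → Fin (n + 1), d β * ∏ l : Fin m, (a - u) l ^ ((β l : ℕ)) = 0 := by
    intro x hx a ha u hu
    obtain ⟨hxI, hxB⟩ := mem_filter.1 hx
    have hCB : C < (B x).card := lt_of_le_of_lt (le_max_left _ _) hxB
    obtain ⟨w, hw⟩ : ∃ w : Fin (C + 1) ↪ (Fin m → F), ∀ j, w j ∈ B x := by
      have h : C + 1 ≤ (B x).card := hCB
      obtain ⟨s, hs, hscard⟩ := Finset.exists_subset_card_eq h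
      refine ⟨(Finset.equivFinOfCardEq hscard).symm.toEmbedding.trans
        (Function.Embedding.subtype _), fun j => hs ?_⟩
      exact Finset.coe_mem _
    exact hdvan x ((hI x).1 hxI) ⟨w, w.injective, fun j => (hB x (w j)).1 (hw j)⟩
      a ((hA x a).1 ha) u ((hC x u).1 hu)
  have hle := stub_shadow_card_le I₁ A B C' hpat₁ hB₁ d hd0 hvan
  have hq0 : (0 : ℝ) ≤ (Fintype.card F : ℝ) ^ ((m : ℝ) - 1) := by positivity
  calc ((∑ x ∈ I.filter (fun x => Cb < (B x).card), (A x).card * (C' x).card : ℕ) : ℝ)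
      ≤ ((m * n : ℕ) : ℝ) * (Fintype.card F : ℝ) ^ ((m : ℝ) - 1) := hle
    _ ≤ (Cb : ℝ) * (Fintype.card F : ℝ) ^ ((m : ℝ) - 1) := by
        apply mul_le_mul_of_nonneg_right _ hq0
        have h1 : m * n ≤ m * N := Nat.mul_le_mul_left m (Nat.lt_succ_iff.1 n.2)
        have h2 : m * N ≤ Cb := le_max_right _ _
        exact_mod_cast h1.trans h2

/-- **NEGATIVE LEMMA: the crux is FALSE conditionally on CDM Prop. (2.7) alone.** -/
theorem PairwiseCurvedTilingsLC_false_of_ChatzidakisVanDenDriesMacintyre1992_prop27 :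
    ChatzidakisVanDenDriesMacintyre1992_prop27 → ¬ PairwiseCurvedTilingsLC :=
  fun h27 => notLC_of_shadowBound (porosityShadowBound_of_prop27_only h27)

end Assembly

end Summit.MatrixMultiplication.MatrixMultiplication.Theorems.PairwiseCurvedTilingsLC.Negative
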